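import Summits.HodgeConjecture.HodgeConjecture.Theorems.Ring2AtlasQuaternionSixfoldOneWeil
import Literature.AlgebraicGeometry.VanGeemenVerra2003.QuaternionicHodgeClasses
import HarnessLib

/-!
# Ring 2 atlas — the general member of the quaternion sixfold cell from the van Geemen–Verra fact

research route conditional on HC_CM; not a corollary; Q11.4-sentence-2 already refuted in dim ≥ 3.
(Cell `pub-hodge-ring2`, seat atlas-2, generation 19, second kernel file for row `g6.III(1)` =
`Ring2.Atlas.HodgeQuaternionSixfold`. Theorems only; no `def`, no `sorry`, no new axiom. `HC_CM` does not occur.)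

WHAT THIS FILE DOES. Generation 19's first file (`Ring2AtlasQuaternionSixfoldOneWeil`) reduced the open cell, per
member, to the algebraicity of ONE Weil plane modulo the typed generation hypothesis (G₁) "every rational `(p,p)`
class lies in `Dᵖ ⊗ ℂ` (`p ≠ 3`), resp. in `D³ ⊗ ℂ + Σ_{ψ ∈ End A} ψ^*(W_φ ⊗ ℂ)`". The Literature skeleton
`VanGeemenVerra2003/QuaternionicHodgeClasses` now vendors van Geemen–Verra 2003 §4.8 (= Abdulali 1999 Thm. 4.1)
as the named fact `VanGeemenVerra2003_quaternionHodgeClasses`, over the degree-one Hodge-group carrier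
(`VanGeemen1994.hodgeGroupOne`) with the predicate `IsGeneralQuaternionType` ("`Hod(A)(ℂ) ≅ SO(2n, ℂ)`": the
Hodge group is of finite index in `G_F(ℂ) = Aut_F(H¹, Q_h) ≅ O(2n, ℂ)`). Here (§1) (G₁) for a GENERAL polarized
abelian variety of quaternion type `(A, E_h, F = ℚ⟨φ, χ⟩)` of dimension `2n ≥ 4` is an INSTANCE of that fact
(`W_F ⊗ ℂ ⊆ Σ_ψ ψ^*(W_φ ⊗ ℂ)`), so (§2) `HC(A)` for such a general member follows from the fact and the
algebraicity of the rational `(n,n)` classes of the one plane `W_{ℚ(φ)}` — and conversely (row word: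
`HC(A) ⟺ (W₁)` modulo [vGV 4.8 fact + `A` general]); (§3) the cell `HodgeQuaternionSixfold` follows from the
fact, the per-member disjunction [`B• = D•` (type II members, Murty 1988) ∨ `A` carries a general quaternion
structure `(φ, χ, h)` with `n = 3`], and `W₆` (or (W₁) per member).

HONEST ACCOUNTING. Compared with the first file, the generation hypothesis (G₁) is REPLACED by [a published
theorem, vendored as a named-fact hypothesis `(h47 : VanGeemenVerra2003_quaternionHodgeClasses)`] + [the
structural hypothesis "`A` is general", `IsGeneralQuaternionType A φ χ 3 h`]. That EVERY simple type III(1)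
sixfold is general (its Hodge group is the full `SO(6)`: no proper connected subgroup of `SO₆` acts irreducibly
and orthogonally on `ℂ⁶`, and `End ⊗ ℚ = F` forces irreducibility) is the cell's DERIVED census (atlas-2
ADDENDUM §23/§35), NOT a tree theorem and NOT asserted here — it is exactly the hypothesis `hgen` of §3 for the
type III members. KIND of `HC_CM`: ABSENT. Audit class of every theorem: proof.conditional / on-path; nothing is
discharged that the tree cannot see.

References: [vanGeemenVerra2003QuaternionicPryms] 2.1, Lemma 4.5, 4.6, Prop. 4.7, 4.8, Cor. 4.9;
[Abdulali1999TypeIII] Thm. 4.1; [Abdulali2002TypeIII] §4, Thm. 4.1, Rem. 5.4; [vanGeemen1994HodgeAV] 4.9, 6.9–6.12;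
[Murty1988] Thm. 2; [MoonenZarhin1999LowDim] (1.8), §5.
-/

set_option linter.dupNamespace false

noncomputable section

namespace Summit.HodgeConjecture.HodgeConjecture.Ring2.Atlas

open CategoryTheory
open Literature.AlgebraicGeometry Literature.AlgebraicGeometry.Motives
open Literature.AlgebraicGeometry.HodgeTheory
open Literature.AlgebraicTopology.SingularHomology
open Literature.Barriers.HodgeConjecture (divisorClassesSpan)
open Literature.AlgebraicGeometry.VanGeemenVerra2003
open Summit.HodgeConjecture.HodgeConjecture.WeilTypeLadder
open Summit.HodgeConjecture.HodgeConjecture.Theses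
open Summit.HodgeConjecture.HodgeConjecture.Ring2.ClassTargets
open Summit.HodgeConjecture.HodgeConjecture.Ring2.Hypotheses
open Summit.HodgeConjecture.HodgeConjecture.Theorems.HodgeAbelianVarieties.Unconditional
  (divisorClassesSpan_le_algebraicClasses_holds hodgeConjectureFor_of_divisorGenerated_holds)

variable {A : AbelianVariety ℂ} {φ χ : A ⟶ A} {n a b : ℕ}

/-! ## §1 (G₁) for the general member is an instance of the van Geemen–Verra fact -/

/-- **(G₁) for a general polarized abelian variety of quaternion type** (`dim A = 2n ≥ 4`, `F = ℚ⟨φ, χ⟩`,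
`φ² = -a`, `χ² = -b`, `φχ = -χφ`, `h = e^*l` with `φ^*h = a h`, `χ^*h = b h`, `A` general): `(A, ℚ(φ))` is of
Weil type `(n, a)` (Lemma 4.5), every rational `(p,p)` class lies in `Dᵖ ⊗ ℂ` for `p ≠ n`, and every rational
`(n,n)` class lies in `Dⁿ ⊗ ℂ + Σ_{ψ ∈ End A} ψ^*(W_φ ⊗ ℂ)` (§4.8 with `W_F ⊗ ℂ ⊆ Σ_ψ ψ^*(W_φ ⊗ ℂ)`, 4.6) — from the
named fact `VanGeemenVerra2003_quaternionHodgeClasses`.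
[cite: vanGeemenVerra2003QuaternionicPryms, Lemma 4.5, 4.6 and 4.8] [cite: Abdulali1999TypeIII, Thm. 4.1] -/
theorem oneWeilTranslatesGenerated_of_vanGeemenVerra2003 (h47 : VanGeemenVerra2003_quaternionHodgeClasses)
    (e : ProjectiveEmbedding A.X) {l : complexBetti (projectiveSpace e.n ℂ) 2} (hn : 2 ≤ n) (ha : 0 < a)
    (hb : 0 < b) (hA : A.dim = 2 * n) (hφ : φ ≫ φ = -(a • 𝟙 A)) (hχ : χ ≫ χ = -(b • 𝟙 A))
    (hφχ : φ ≫ χ = -(χ ≫ φ)) (hl : IsRationalClass l) (hl0 : l ≠ 0)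
    (hEφ : complexBetti.map φ.hom.hom.hom 2 (complexBetti.map e.ι 2 l) = (a : ℂ) • complexBetti.map e.ι 2 l)
    (hEχ : complexBetti.map χ.hom.hom.hom 2 (complexBetti.map e.ι 2 l) = (b : ℂ) • complexBetti.map e.ι 2 l)
    (hgen : IsGeneralQuaternionType A φ χ n (complexBetti.map e.ι 2 l)) :
    IsWeilType A φ n a ∧
      (∀ (p : ℕ) (c : complexBetti A.X (2 * p)), p ≠ n → IsRationalClass c →
          IsOfHodgeType A.dim A.X (2 * p) p p c → c ∈ divisorClassesSpan A.X A.dim p) ∧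
      ∀ c : complexBetti A.X (2 * n), IsRationalClass c → IsOfHodgeType A.dim A.X (2 * n) n n c →
        c ∈ divisorClassesSpan A.X A.dim n ⊔
          ⨆ ψ : A ⟶ A, (weilClassesOf A φ n a).map (complexBetti.map ψ.hom.hom.hom (2 * n)).hom := by
  refine ⟨h47.isWeilType e hn ha hb hA hφ hχ hφχ hl hl0 hEφ hEχ, ?_⟩
  obtain ⟨hoff, hmid⟩ := h47.divisorQuaternionGenerated e hn ha hb hA hφ hχ hφχ hl hl0 hEφ hEχ hgen
  exact ⟨hoff, fun c hc hH ↦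
    sup_le_sup_left (quaternionClasses_le_iSup_map (φ := φ) (χ := χ) φ n a) _ (hmid c hc hH)⟩

/-! ## §2 `HC` of a general abelian variety of quaternion type ⟺ ONE Weil plane is algebraic -/

/-- **`HC(A)` for a GENERAL polarized abelian variety of quaternion type of dimension `2n ≥ 4`, from the van
Geemen–Verra fact and the algebraicity of the rational `(n,n)` classes of ONE Weil plane `W_{ℚ(φ)}`** (the ENGINE
of the first file fed with §1; Cor. 4.9 is the mechanism). For `n = 3` these are the general simple abelian
sixfolds with definite quaternion multiplication. [cite: vanGeemenVerra2003QuaternionicPryms, 4.8 and Cor. 4.9]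
[cite: Abdulali1999TypeIII, Thm. 4.1] -/
theorem hodgeConjectureFor_of_vanGeemenVerra2003_of_general (h47 : VanGeemenVerra2003_quaternionHodgeClasses)
    (e : ProjectiveEmbedding A.X) {l : complexBetti (projectiveSpace e.n ℂ) 2} (hn : 2 ≤ n) (ha : 0 < a)
    (hb : 0 < b) (hA : A.dim = 2 * n) (hφ : φ ≫ φ = -(a • 𝟙 A)) (hχ : χ ≫ χ = -(b • 𝟙 A))
    (hφχ : φ ≫ χ = -(χ ≫ φ)) (hl : IsRationalClass l) (hl0 : l ≠ 0)
    (hEφ : complexBetti.map φ.hom.hom.hom 2 (complexBetti.map e.ι 2 l) = (a : ℂ) • complexBetti.map e.ι 2 l)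
    (hEχ : complexBetti.map χ.hom.hom.hom 2 (complexBetti.map e.ι 2 l) = (b : ℂ) • complexBetti.map e.ι 2 l)
    (hgen : IsGeneralQuaternionType A φ χ n (complexBetti.map e.ι 2 l))
    (hW : ∀ c ∈ weilClassesOf A φ n a, IsRationalClass c → IsOfHodgeType (2 * n) A.X (2 * n) n n c →
      c ∈ algebraicClasses A.X n) :
    HodgeConjectureFor A.dim A.X := by
  obtain ⟨hWT, hoff, hmid⟩ :=
    oneWeilTranslatesGenerated_of_vanGeemenVerra2003 h47 e hn ha hb hA hφ hχ hφχ hl hl0 hEφ hEχ hgen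
  exact hodgeConjectureFor_of_oneWeilTranslatesGenerated hWT hoff hmid hW

/-- **ROW WORD for the general member: `HC(A) ⟺` the rational `(n,n)` classes of ONE Weil plane are algebraic,
modulo [van Geemen–Verra 4.8, a theorem in print, as hypothesis `h47`] and [`A` general].**
[cite: vanGeemenVerra2003QuaternionicPryms, 4.8 and Cor. 4.9] [cite: vanGeemen1994HodgeAV, Lemma 5.2 (3)] -/
theorem hodgeConjectureFor_iff_weilClassesOf_algebraic_of_vanGeemenVerra2003_of_general
    (h47 : VanGeemenVerra2003_quaternionHodgeClasses)
    (e : ProjectiveEmbedding A.X) {l : complexBetti (projectiveSpace e.n ℂ) 2} (hn : 2 ≤ n) (ha : 0 < a)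
    (hb : 0 < b) (hA : A.dim = 2 * n) (hφ : φ ≫ φ = -(a • 𝟙 A)) (hχ : χ ≫ χ = -(b • 𝟙 A))
    (hφχ : φ ≫ χ = -(χ ≫ φ)) (hl : IsRationalClass l) (hl0 : l ≠ 0)
    (hEφ : complexBetti.map φ.hom.hom.hom 2 (complexBetti.map e.ι 2 l) = (a : ℂ) • complexBetti.map e.ι 2 l)
    (hEχ : complexBetti.map χ.hom.hom.hom 2 (complexBetti.map e.ι 2 l) = (b : ℂ) • complexBetti.map e.ι 2 l)
    (hgen : IsGeneralQuaternionType A φ χ n (complexBetti.map e.ι 2 l)) :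
    HodgeConjectureFor A.dim A.X ↔
      ∀ c ∈ weilClassesOf A φ n a, IsRationalClass c → IsOfHodgeType (2 * n) A.X (2 * n) n n c →
        c ∈ algebraicClasses A.X n := by
  obtain ⟨hWT, hoff, hmid⟩ :=
    oneWeilTranslatesGenerated_of_vanGeemenVerra2003 h47 e hn ha hb hA hφ hχ hφχ hl hl0 hEφ hEχ hgen
  exact hodgeConjectureFor_iff_weilClassesOf_algebraic_of_oneWeilTranslatesGenerated hWT hoff hmid

/-! ## §3 The cell from the fact, generality of the type III members, and `W₆` -/

/-- **Cell `HodgeQuaternionSixfold` ⟸ [van Geemen–Verra 4.8 fact] + [per member: `B• = D•` (the type II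
members, Murty 1988 Thm. 2) ∨ the member carries a general quaternion structure `(φ, χ, h)` with `n = 3`
(the type III(1) members; "general" DERIVED for all of them in the cell's records, not in the tree)] + `W₆`.**
The generation input of the first file's cell theorem is thereby discharged to print plus the structural
Hodge-group hypothesis. [cite: vanGeemenVerra2003QuaternionicPryms, 4.8 and Cor. 4.9] [cite: Abdulali1999TypeIII, Thm. 4.1]
[cite: Murty1988, Thm. 2] [cite: MoonenZarhin1999LowDim, (1.8) and §5] -/
theorem hodgeQuaternionSixfold_of_vanGeemenVerra2003_of_general_of_weilSixfolds
    (h47 : VanGeemenVerra2003_quaternionHodgeClasses)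
    (hgen : ∀ A : AbelianVariety ℂ, A.dim = 6 ∧ A.IsSimple ∧ (∃ ψ χ : A ⟶ A, ψ ≫ χ ≠ χ ≫ ψ) ∧
      HasNoTypeIVFactor A →
      (∀ (p : ℕ) (c : complexBetti A.X (2 * p)), IsRationalClass c → IsOfHodgeType A.dim A.X (2 * p) p p c →
          c ∈ divisorClassesSpan A.X A.dim p) ∨
        ∃ (φ χ : A ⟶ A) (a b : ℕ) (e : ProjectiveEmbedding A.X) (l : complexBetti (projectiveSpace e.n ℂ) 2),
          0 < a ∧ 0 < b ∧ φ ≫ φ = -(a • 𝟙 A) ∧ χ ≫ χ = -(b • 𝟙 A) ∧ φ ≫ χ = -(χ ≫ φ) ∧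
          IsRationalClass l ∧ l ≠ 0 ∧
          complexBetti.map φ.hom.hom.hom 2 (complexBetti.map e.ι 2 l) = (a : ℂ) • complexBetti.map e.ι 2 l ∧
          complexBetti.map χ.hom.hom.hom 2 (complexBetti.map e.ι 2 l) = (b : ℂ) • complexBetti.map e.ι 2 l ∧
          IsGeneralQuaternionType A φ χ 3 (complexBetti.map e.ι 2 l))
    (hW₆ : SevenfoldWeilCensus.WeilSixfolds) : HodgeQuaternionSixfold := by
  intro A hA
  rcases hgen A hA with hD | ⟨φ, χ, a, b, e, l, ha, hb, hφ, hχ, hφχ, hl, hl0, hEφ, hEχ, hg⟩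
  · exact hodgeConjectureFor_of_divisorGenerated_holds A hD
  · have h6 : A.dim = 2 * 3 := by rw [hA.1]
    obtain ⟨hWT, hoff, hmid⟩ :=
      oneWeilTranslatesGenerated_of_vanGeemenVerra2003 h47 e (by norm_num) ha hb h6 hφ hχ hφχ hl hl0 hEφ hEχ hg
    exact hodgeConjectureFor_of_oneWeilTranslatesGenerated hWT hoff hmid
      (weilClasses_algebraic_of_weilSixfolds hW₆ A hA.1 3 a φ hWT)

/-- **Cell ⟸ fact + per member [`B• = D•` ∨ a general quaternion structure whose plane `W_{ℚ(φ)}` has algebraic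
rational `(3,3)` classes (W₁)]** — no `W₆`. [cite: vanGeemenVerra2003QuaternionicPryms, 4.8 and Cor. 4.9]
[cite: Abdulali1999TypeIII, Thm. 4.1] [cite: Murty1988, Thm. 2] -/
theorem hodgeQuaternionSixfold_of_vanGeemenVerra2003_of_general
    (h47 : VanGeemenVerra2003_quaternionHodgeClasses)
    (hgen : ∀ A : AbelianVariety ℂ, A.dim = 6 ∧ A.IsSimple ∧ (∃ ψ χ : A ⟶ A, ψ ≫ χ ≠ χ ≫ ψ) ∧
      HasNoTypeIVFactor A →
      (∀ (p : ℕ) (c : complexBetti A.X (2 * p)), IsRationalClass c → IsOfHodgeType A.dim A.X (2 * p) p p c →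
          c ∈ divisorClassesSpan A.X A.dim p) ∨
        ∃ (φ χ : A ⟶ A) (a b : ℕ) (e : ProjectiveEmbedding A.X) (l : complexBetti (projectiveSpace e.n ℂ) 2),
          0 < a ∧ 0 < b ∧ φ ≫ φ = -(a • 𝟙 A) ∧ χ ≫ χ = -(b • 𝟙 A) ∧ φ ≫ χ = -(χ ≫ φ) ∧
          IsRationalClass l ∧ l ≠ 0 ∧
          complexBetti.map φ.hom.hom.hom 2 (complexBetti.map e.ι 2 l) = (a : ℂ) • complexBetti.map e.ι 2 l ∧
          complexBetti.map χ.hom.hom.hom 2 (complexBetti.map e.ι 2 l) = (b : ℂ) • complexBetti.map e.ι 2 l ∧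
          IsGeneralQuaternionType A φ χ 3 (complexBetti.map e.ι 2 l) ∧
          ∀ c ∈ weilClassesOf A φ 3 a, IsRationalClass c → IsOfHodgeType (2 * 3) A.X (2 * 3) 3 3 c →
            c ∈ algebraicClasses A.X 3) :
    HodgeQuaternionSixfold := by
  intro A hA
  rcases hgen A hA with hD | ⟨φ, χ, a, b, e, l, ha, hb, hφ, hχ, hφχ, hl, hl0, hEφ, hEχ, hg, hW⟩
  · exact hodgeConjectureFor_of_divisorGenerated_holds A hD
  · have h6 : A.dim = 2 * 3 := by rw [hA.1]
    exact hodgeConjectureFor_of_vanGeemenVerra2003_of_general h47 e (by norm_num) ha hb h6 hφ hχ hφχ hl hl0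
      hEφ hEχ hg hW

/-! ## §4 ON PATH: the quaternion classes of every member are algebraic under the cell -/

/-- **Under the cell (hence under `HC_AV`, hence under the summit) the quaternion classes `W_F ⊗ ℂ` of every Weil
structure of every member are algebraic** (Cor. 4.9 applied to the consequence (W₁) of the cell).
[cite: vanGeemenVerra2003QuaternionicPryms, Cor. 4.9] [cite: vanGeemen1994HodgeAV, Lemma 5.2 (3)] -/
theorem quaternionClasses_algebraic_of_hodgeQuaternionSixfold (hQ : HodgeQuaternionSixfold) (A : AbelianVariety ℂ)
    (hA : A.dim = 6 ∧ A.IsSimple ∧ (∃ ψ χ : A ⟶ A, ψ ≫ χ ≠ χ ≫ ψ) ∧ HasNoTypeIVFactor A) (φ χ ψ : A ⟶ A)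
    (d : ℕ) (hWT : IsWeilType A ψ 3 d) :
    quaternionClasses A φ χ ψ 3 d ≤ algebraicClasses A.X 3 :=
  quaternionClasses_le_algebraicClasses_of_isWeilType hWT
    (weilClassesOf_algebraic_of_hodgeQuaternionSixfold hQ A hA ψ d hWT)

end Summit.HodgeConjecture.HodgeConjecture.Ring2.Atlas
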